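import Mathlib
import Summits.Ventures.DiscreteObjects.Mahler.CensusCertificateX
import Summits.Ventures.DiscreteObjects.Mahler.CensusPackedArith

/-!
# The census search with a packed (Kronecker) leaf test (venture `DiscreteObjects`, target L)

Cell `pub-namedobj`, seat `pub-namedobj-mahler-g20` (pipeline of seats g12–g19). Framing: lottery ticket; floor = certified
bounds/negative ranges.

`censusSearchP T CT d NJ fuel pre ps Sacc Cacc Hacc Dacc` walks the SAME tree as the census search `censusSearchC T CT fuel pre ps`
(mahler g13, `CensusSearchCuts`: coefficients `c_1,…,c_d` of a monic palindromic polynomial of degree `2d`, windows from the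
cut table `CT` and the thresholds `T`) and carries, besides the lists, four packed naturals — the power sums `Sacc = packS ps`,
the coefficients `Cacc = packFrom 1 pre`, their mirror images `Hacc` (the upper half `c_{2d-i} = c_i` of the palindromic
coefficient list) and the packed terms `k·c_k` of the upper half `Dacc` — so that at the last level the leaf test runs as the
packed loop `leafLoopP` of `CensusPackedArith` (one kernel big-integer multiplication per Newton step, from `P_{d+1}` on), and a
leaf divisible by `x ± 1, Φ₃, Φ₄, Φ₆` is dropped (`junkK`: the residue pre-test and validated `red` certificate of mahler g19's
`CensusSearchFastJ`, restated here because that module is not yet built).  TRANSFER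
(`mem_censusSearchP_or_junk`): every survivor of `censusSearchC` is a survivor of `censusSearchP` or a junk leaf; hence a kernel
check `allCertifiedX … (censusSearchPs T CT d NJ fuel pre) certs = true` certifies every survivor of `censusSearchC`
(`forall_certX_of_allCertifiedPs`) and the census verdict `degreeCensus_of_certified_nonnegXC` applies unchanged.
Infrastructure only; no census row is claimed here.
-/

namespace Summit.Ventures.DiscreteObjects.Mahler

open Polynomial

/-! ## Packing lemmas: the kernel's accumulators are the ghosts' values -/

/-- `packFrom` as a sum. -/
theorem packFrom_eq_sum (s : ℕ) (l : List ℤ) :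
    packFrom s l = ∑ i ∈ Finset.range l.length, enc (l.getD i 0) * pG ^ (s + i) := by
  induction l generalizing s with
  | nil => simp [packFrom]
  | cons x l ih =>
    rw [packFrom, ih, List.length_cons, Finset.sum_range_succ']
    simp only [List.getD_cons_succ, List.getD_cons_zero, add_zero]
    rw [add_comm]
    exact congrArg₂ _ (Finset.sum_congr rfl fun i _ => by rw [show s + (i + 1) = s + 1 + i by omega]) rfl

/-- `packFrom` of a concatenation. -/
theorem packFrom_append (s : ℕ) (l l' : List ℤ) : packFrom s (l ++ l') = packFrom s l + packFrom (s + l.length) l' := by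
  induction l generalizing s with
  | nil => simp [packFrom]
  | cons x l ih =>
    rw [List.cons_append, packFrom, packFrom, ih, List.length_cons, show s + 1 + l.length = s + (l.length + 1) by omega]
    ring

/-- The coefficient ghost evaluates to the packed coefficients. -/
theorem eval_cPoly (cs : List ℤ) : (cPoly cs).eval pG = packFrom 1 cs := by
  rw [packFrom_eq_sum, cPoly, eval_finsetSum]
  exact Finset.sum_congr rfl fun i _ => by simp [add_comm]

/-- `packFromD` as a sum. -/
theorem packFromD_eq_sum (s : ℕ) (l : List ℤ) :
    packFromD s l = ∑ i ∈ Finset.range l.length, enc (((s + i : ℕ) : ℤ) * l.getD i 0) * pG ^ (s + i) := by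
  induction l generalizing s with
  | nil => simp [packFromD]
  | cons x l ih =>
    rw [packFromD, ih, List.length_cons, Finset.sum_range_succ']
    simp only [List.getD_cons_succ, List.getD_cons_zero, add_zero]
    rw [add_comm]
    exact congrArg₂ _ (Finset.sum_congr rfl fun i _ => by rw [show s + (i + 1) = s + 1 + i by omega]) rfl

/-- `packFromD` of a concatenation. -/
theorem packFromD_append (s : ℕ) (l l' : List ℤ) :
    packFromD s (l ++ l') = packFromD s l + packFromD (s + l.length) l' := by
  induction l generalizing s with
  | nil => simp [packFromD]
  | cons x l ih =>
    rw [List.cons_append, packFromD, packFromD, ih, List.length_cons, show s + 1 + l.length = s + (l.length + 1) by omega]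
    ring

/-- The `k·c_k` ghost from slot `lo ≥ 1` evaluates to the packed tail. -/
theorem eval_dPoly (cs : List ℤ) (lo : ℕ) (hlo : 1 ≤ lo) : (dPoly cs lo).eval pG = packFromD lo (cs.drop (lo - 1)) := by
  rw [packFromD_eq_sum, dPoly, eval_finsetSum, Finset.sum_Ico_eq_sum_range, List.length_drop,
    show cs.length + 1 - lo = cs.length - (lo - 1) by omega]
  refine Finset.sum_congr rfl fun i _ => ?_
  simp only [eval_mul, eval_C, eval_pow, eval_X, List.getD_eq_getElem?_getD, List.getElem?_drop,
    show lo + i - 1 = lo - 1 + i by omega]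

/-- Ghost digits of a power-sum list `[P_n,…,P_1]`: slot `j` holds `enc P_j`. -/
def sigma0 (prev : List ℤ) (j : ℕ) : ℕ := if j = 0 then 0 else enc (prev.getD (prev.length - j) 0)

/-- The power-sum ghost evaluates to the packed power sums. -/
theorem packS_eq_eval (prev : List ℤ) : packS prev = (sPoly (sigma0 prev) (prev.length + 1)).eval pG := by
  have hev : ∀ (σ : ℕ → ℕ) (k : ℕ), (sPoly σ k).eval pG = ∑ j ∈ Finset.range k, σ j * pG ^ j := by
    intro σ k; rw [sPoly, eval_finsetSum]; simp
  rw [hev]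
  induction prev with
  | nil => simp [packS, sigma0]
  | cons p ps ih =>
    rw [packS, ih, List.length_cons, Finset.sum_range_succ (n := ps.length + 1)]
    have htop : sigma0 (p :: ps) (ps.length + 1) = enc p := by simp [sigma0]
    rw [htop, add_comm]
    congr 1
    refine Finset.sum_congr rfl fun j hj => ?_
    rw [Finset.mem_range] at hj
    unfold sigma0
    split_ifs with h0
    · rfl
    · rw [List.length_cons, show ps.length + 1 - j = (ps.length - j) + 1 by omega, List.getD_cons_succ]

/-- The ghost digits are congruent to the power sums. -/
theorem sigma0_cast (prev : List ℤ) (i : ℕ) (hi : i < prev.length) :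
    ((sigma0 prev (prev.length + 1 - 1 - i) : ℕ) : ZMod pW) = ((prev.getD i 0 : ℤ) : ZMod pW) := by
  rw [sigma0, if_neg (by omega), show prev.length - (prev.length + 1 - 1 - i) = i by omega, cast_enc]

/-- The ghost digits are small. -/
theorem sigma0_lt (prev : List ℤ) (j : ℕ) : sigma0 prev j < 4 * pW := by
  unfold sigma0; split_ifs
  · exact Nat.mul_pos (by norm_num) pW_pos
  · exact (enc_lt _).trans_le (Nat.le_mul_of_pos_left _ (by norm_num))

/-! ## Exact division by a polynomial with unit constant term (ascending lists) -/

/-- Power-series division from the low end: `m` quotient coefficients of `r / f`, where `f0inv = f₀ = ±1`. Untrusted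
(the result is validated by `lpEq (lpMul f q) asc`). -/
def quotLowK (f : List ℤ) (f0inv : ℤ) : ℕ → List ℤ → List ℤ
  | 0, _ => []
  | m + 1, r =>
    let c := f0inv * r.headD 0
    c :: quotLowK f f0inv m (lpAdd r (lpSMul (-c) f)).tail

/-- The reducibility check of the census certificates for the factor `f` with the quotient found by `quotLowK`. -/
def junkFactorK (asc f : List ℤ) (f0inv : ℤ) (m : ℕ) : Bool :=
  lpPosDegree f && lpPosDegree (quotLowK f f0inv m asc) && lpEq (lpMul f (quotLowK f f0inv m asc)) asc

/-- Sums of the entries in the residue classes mod 12 of the positions (input padded to a multiple of 12). -/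
def bins12K : List ℤ → ℤ → ℤ → ℤ → ℤ → ℤ → ℤ → ℤ → ℤ → ℤ → ℤ → ℤ → ℤ → List ℤ
  | a0 :: a1 :: a2 :: a3 :: a4 :: a5 :: a6 :: a7 :: a8 :: a9 :: a10 :: a11 :: rest,
      b0, b1, b2, b3, b4, b5, b6, b7, b8, b9, b10, b11 =>
    bins12K rest (b0 + a0) (b1 + a1) (b2 + a2) (b3 + a3) (b4 + a4) (b5 + a5) (b6 + a6) (b7 + a7) (b8 + a8) (b9 + a9)
      (b10 + a10) (b11 + a11)
  | _, b0, b1, b2, b3, b4, b5, b6, b7, b8, b9, b10, b11 => [b0, b1, b2, b3, b4, b5, b6, b7, b8, b9, b10, b11]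

/-- Cheap necessary tests (values at the roots of unity of order 1, 2, 3, 4, 6) from the residue sums `b`; heuristic filters only
(soundness rests on the validated factorisation). Order: `[x-1, x+1, Φ₃, Φ₄, Φ₆]`. -/
def junkPreK (b : List ℤ) : List Bool :=
  let g := fun i => b.getD i 0
  let s0 := g 0 + g 3 + g 6 + g 9
  let s1 := g 1 + g 4 + g 7 + g 10
  let s2 := g 2 + g 5 + g 8 + g 11
  let t0 := g 0 + g 6
  let t1 := g 1 + g 7
  let t2 := g 2 + g 8
  let t3 := g 3 + g 9
  let t4 := g 4 + g 10
  let t5 := g 5 + g 11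
  [decide (s0 + s1 + s2 = 0), decide (t0 - t1 + t2 - t3 + t4 - t5 = 0), decide (s0 = s2 ∧ s1 = s2),
    decide (g 0 - g 2 + g 4 - g 6 + g 8 - g 10 = 0 ∧ g 1 - g 3 + g 5 - g 7 + g 9 - g 11 = 0),
    decide (t0 - t2 - t3 + t5 = 0 ∧ t1 + t2 - t4 - t5 = 0)]

/-- `asc` (ascending coefficients, `m + 1` of them) is divisible by `x - 1`, `x + 1`, `Φ₃`, `Φ₄` or `Φ₆`
(cheap residue pre-test, then a validated factorisation). -/
def junkK (asc : List ℤ) (m : ℕ) : Bool :=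
  let pre := junkPreK (bins12K (asc ++ List.replicate 11 0) 0 0 0 0 0 0 0 0 0 0 0 0)
  (pre.getD 0 false && junkFactorK asc [-1, 1] (-1) m) || (pre.getD 1 false && junkFactorK asc [1, 1] 1 m) ||
    (pre.getD 2 false && junkFactorK asc [1, 1, 1] 1 (m - 1)) || (pre.getD 3 false && junkFactorK asc [1, 0, 1] 1 (m - 1)) ||
    (pre.getD 4 false && junkFactorK asc [1, -1, 1] 1 (m - 1))

/-- A positive junk test IS a valid `red` certificate. -/
theorem exists_certX_of_junkK {Bn Bd d : ℕ} {L : List (List ℤ)} {LC : List (List ℤ × ℤ)} {asc : List ℤ} {m : ℕ}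
    (h : junkK asc m = true) : ∃ c, checkCertX Bn Bd d L LC asc c = true := by
  unfold junkK at h
  simp only [Bool.or_eq_true, Bool.and_eq_true] at h
  rcases h with (((⟨_, h⟩ | ⟨_, h⟩) | ⟨_, h⟩) | ⟨_, h⟩) | ⟨_, h⟩
  · exact ⟨CertX.base (Cert.red [-1, 1] (quotLowK [-1, 1] (-1) m asc)), h⟩
  · exact ⟨CertX.base (Cert.red [1, 1] (quotLowK [1, 1] 1 m asc)), h⟩
  · exact ⟨CertX.base (Cert.red [1, 1, 1] (quotLowK [1, 1, 1] 1 (m - 1) asc)), h⟩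
  · exact ⟨CertX.base (Cert.red [1, 0, 1] (quotLowK [1, 0, 1] 1 (m - 1) asc)), h⟩
  · exact ⟨CertX.base (Cert.red [1, -1, 1] (quotLowK [1, -1, 1] 1 (m - 1) asc)), h⟩

/-! ## The search -/

/-- The packed leaf loop with the junk test run once after `cd` Newton steps (a junk leaf is dropped). -/
def leafLoopPJ (cf : ℕ) (asc : List ℤ) (m : ℕ) : ℕ → List ℕ → ℕ → ℕ → Bool
  | 0, ts, Z, g => !(junkK asc m) && leafLoopP cf ts Z g
  | _ + 1, [], _, _ => !(junkK asc m)
  | cd + 1, t :: ts, Z, g =>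
    let a := pW2 - Z / g % pW
    decide ((a + t) % pW ≤ 2 * t) && leafLoopPJ cf asc m cd ts (Z + a * g * cf) (g * pG)

/-- For a non-junk leaf the countdown loop is the packed loop. -/
theorem leafLoopPJ_eq_of_not_junk {cf : ℕ} {asc : List ℤ} {m : ℕ} (hj : junkK asc m = false) :
    ∀ (cd : ℕ) (ts : List ℕ) (Z g : ℕ), leafLoopPJ cf asc m cd ts Z g = leafLoopP cf ts Z g := by
  intro cd
  induction cd with
  | zero => intro ts Z g; simp [leafLoopPJ, hj]
  | succ cd ih =>
    intro ts Z g
    cases ts with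
    | nil => simp [leafLoopPJ, leafLoopP, hj]
    | cons t ts => simp only [leafLoopPJ, leafLoopP, ih]

/-- **The census search with packed accumulators and the packed leaf test** (`d` = half degree, `NJ` = Newton steps before the
junk test; `Sacc, Cacc, Hacc, Dacc` = packed power sums, coefficients, mirrored coefficients, mirrored `k·c_k`). -/
def censusSearchP (T : List ℕ) (CT : List (List (List ℤ × ℤ))) (d NJ : ℕ) :
    ℕ → List ℤ → List ℤ → ℕ → ℕ → ℕ → ℕ → List (List ℤ)
  | 0, pre, ps, _, _, _, _ => if leafPass (palC pre) (T.drop pre.length) ps then [pre] else []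
  | fuel + 1, pre, ps, Sacc, Cacc, Hacc, Dacc =>
    let n := pre.length
    let R : ℤ := -(List.zipWith (· * ·) pre ps).sum
    let kz : ℤ := ((n + 1 : ℕ) : ℤ)
    let Tk : ℤ := ((T.getD n 0 : ℕ) : ℤ)
    let b := cutBounds (CT.getD n []) ps (-Tk) Tk
    let lo := -((b.2 - R) / kz)
    let hi := (R - b.1) / kz
    let g := pG ^ (n + 1)
    let m := 2 * d - (n + 1)
    let child := fun ak : ℤ =>
      censusSearchP T CT d NJ fuel (pre ++ [ak]) ((-(kz * ak) + R) :: ps) (Sacc + enc (-(kz * ak) + R) * g)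
        (Cacc + enc ak * g) (Hacc + enc ak * pG ^ m) (Dacc + enc ((m : ℕ) * ak) * pG ^ m)
    if fuel = 0 then
      let h := pG ^ (2 * d)
      (icc lo hi).flatMap fun ak =>
        let cf := Cacc + enc ak * g + Hacc + h
        let Z := cf * (Sacc + enc (-(kz * ak) + R) * g) + (Dacc + enc ((2 * d : ℕ) : ℤ) * h)
        if leafLoopPJ cf (1 :: palC (pre ++ [ak])) (2 * d) NJ (T.drop (n + 1)) Z (g * pG) then [pre ++ [ak]] else []
    else (icc lo hi).flatMap child

/-- **The search from a node**: the packed accumulators are computed from the prefix `pre` (power sums `psumsRev pre |pre|`). -/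
def censusSearchPs (T : List ℕ) (CT : List (List (List ℤ × ℤ))) (d NJ fuel : ℕ) (pre : List ℤ) : List (List ℤ) :=
  censusSearchP T CT d NJ fuel pre (psumsRev pre pre.length) (packS (psumsRev pre pre.length)) (packFrom 1 pre)
    (packFrom (2 * d - pre.length) pre.reverse) (packFromD (2 * d - pre.length) pre.reverse)

/-! ## Transfer -/

/-- `enc 1 = 1`. -/
theorem enc_one : enc 1 = 1 := by decide

/-- **Transfer**: every survivor of `censusSearchC` is a survivor of `censusSearchP` (run with the true packed accumulators) or a
junk leaf (thresholds `< 2^61`, at most `62` of them, `d ≤ 62`). -/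
theorem mem_censusSearchP_or_junk {T : List ℕ} {CT : List (List (List ℤ × ℤ))} {d NJ : ℕ} (hT : ∀ t ∈ T, t < 2 ^ 61)
    (hTl : T.length ≤ 62) (hdl : d ≤ 62) : ∀ (fuel : ℕ) (pre ps a : List ℤ) (Sacc Cacc Hacc Dacc : ℕ), ps.length = pre.length →
      1 ≤ pre.length → pre.length + fuel = d → Sacc = packS ps → Cacc = packFrom 1 pre →
      Hacc = packFrom (2 * d - pre.length) pre.reverse → Dacc = packFromD (2 * d - pre.length) pre.reverse →
      a ∈ censusSearchC T CT fuel pre ps →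
        a ∈ censusSearchP T CT d NJ fuel pre ps Sacc Cacc Hacc Dacc ∨ junkK (1 :: palC a) (2 * d) = true := by
  intro fuel
  induction fuel with
  | zero =>
    intro pre ps a Sacc Cacc Hacc Dacc _ _ _ _ _ _ _ ha
    left
    rw [censusSearchC] at ha
    rw [censusSearchP]
    exact ha
  | succ fuel ih =>
    intro pre ps a Sacc Cacc Hacc Dacc hlen h1 hd hS hC hH hD ha
    rw [mem_censusSearchC_succ_iff] at ha
    obtain ⟨ak, hak, ha⟩ := ha
    rw [mem_icc] at hak
    obtain ⟨hlo, hhi⟩ := hak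
    by_cases hj : junkK (1 :: palC a) (2 * d) = true
    · exact Or.inr hj
    left
    simp only [Bool.not_eq_true] at hj
    have hlen' : (nodeP pre ps ak :: ps).length = (pre ++ [ak]).length := by simp [hlen]
    have h1' : 1 ≤ (pre ++ [ak]).length := by simp
    have hd' : (pre ++ [ak]).length + fuel = d := by simp; omega
    have hle : pre.length + 1 ≤ 2 * d := by omega
    -- the accumulators of the child
    have hS' : Sacc + enc (nodeP pre ps ak) * pG ^ (pre.length + 1) = packS (nodeP pre ps ak :: ps) := by
      rw [packS, hS, hlen, add_comm]
    have hC' : Cacc + enc ak * pG ^ (pre.length + 1) = packFrom 1 (pre ++ [ak]) := by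
      rw [packFrom_append, hC, packFrom, packFrom, add_zero, add_comm 1 pre.length]
    have hrev : (pre ++ [ak]).reverse = ak :: pre.reverse := by simp
    have hH' : Hacc + enc ak * pG ^ (2 * d - (pre.length + 1)) =
        packFrom (2 * d - (pre ++ [ak]).length) (pre ++ [ak]).reverse := by
      rw [hrev, List.length_append, List.length_singleton, packFrom, hH,
        show 2 * d - (pre.length + 1) + 1 = 2 * d - pre.length by omega, add_comm]
    have hD' : Dacc + enc (((2 * d - (pre.length + 1) : ℕ) : ℤ) * ak) * pG ^ (2 * d - (pre.length + 1)) =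
        packFromD (2 * d - (pre ++ [ak]).length) (pre ++ [ak]).reverse := by
      rw [hrev, List.length_append, List.length_singleton, packFromD, hD,
        show 2 * d - (pre.length + 1) + 1 = 2 * d - pre.length by omega, add_comm]
    have ih' := fun h => (ih (pre ++ [ak]) (nodeP pre ps ak :: ps) a _ _ _ _ hlen' h1' hd' hS' hC' hH' hD' h).resolve_right
      (by rw [hj]; decide)
    rw [censusSearchP]
    dsimp only
    split_ifs with hf
    · subst hf
      rw [censusSearchC] at ha
      simp only [List.length_append, List.length_singleton] at ha
      split_ifs at ha with hleaf
      · simp only [List.mem_singleton] at ha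
        subst ha
        have hd1 : pre.length + 1 = d := by omega
        subst hd1
        simp only [List.mem_flatMap, mem_icc]
        refine ⟨ak, ⟨hlo, hhi⟩, ?_⟩
        set cs := palC (pre ++ [ak]) with hcs
        have hcs' : cs = pre ++ [ak] ++ (pre.reverse ++ [1]) := by simp [hcs, palC]
        set prev := nodeP pre ps ak :: ps with hprev
        have hplen : prev.length + 1 = pre.length + 1 + 1 := by simp [hprev, hlen]
        have hts : ∀ t' ∈ T.drop (pre.length + 1), t' < 2 ^ 61 := fun t' ht' => hT t' (List.mem_of_mem_drop ht')
        have htl : pre.length + 1 + 1 + (T.drop (pre.length + 1)).length ≤ 64 := by rw [List.length_drop]; omega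
        -- values of the packed accumulators at the leaf
        have hCf : Cacc + enc ak * pG ^ (pre.length + 1) + Hacc + pG ^ (2 * (pre.length + 1)) = (cPoly cs).eval pG := by
          rw [eval_cPoly, hcs', packFrom_append, packFrom_append, packFrom_append, List.length_append,
            List.length_singleton, List.length_reverse, hC, hH]
          simp only [packFrom, enc_one, one_mul, add_zero]
          rw [show 2 * (pre.length + 1) - pre.length = 1 + (pre.length + 1) by omega,
            show 2 * (pre.length + 1) = 1 + (pre.length + 1) + pre.length by omega,
            show 1 + pre.length = pre.length + 1 by omega]
          ring
        have hSv : packS prev = (sPoly (sigma0 prev) (pre.length + 1 + 1)).eval pG := by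
          rw [← hplen]; exact packS_eq_eval prev
        have hDv : packFromD (pre.length + 1 + 1) (pre.reverse ++ [1]) = (dPoly cs (pre.length + 1 + 1)).eval pG := by
          rw [eval_dPoly _ _ (by omega), show pre.length + 1 + 1 - 1 = (pre ++ [ak]).length by simp, hcs', List.drop_left]
        have hfin : ∀ cf' Z' : ℕ, cf' = (cPoly cs).eval pG →
            Z' = cf' * packS prev + packFromD (pre.length + 1 + 1) (pre.reverse ++ [1]) →
            pre ++ [ak] ∈ (if leafLoopPJ cf' (1 :: cs) (2 * (pre.length + 1)) NJ (T.drop (pre.length + 1)) Z'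
              (pG ^ (pre.length + 1) * pG) then [pre ++ [ak]] else []) := by
          intro cf' Z' hcf' hZ'
          have hZ'' : Z' = (cPoly cs * sPoly (sigma0 prev) (pre.length + 1 + 1) + dPoly cs (pre.length + 1 + 1)).eval pG := by
            rw [hZ', eval_add, eval_mul, ← hcf', hSv, hDv]
          have hF : leafLoopPJ cf' (1 :: cs) (2 * (pre.length + 1)) NJ (T.drop (pre.length + 1)) Z'
              (pG ^ (pre.length + 1) * pG) = true := by
            rw [leafLoopPJ_eq_of_not_junk hj]
            exact leafLoopP_of_leafPass cs (pre.length + 1 + 1) cf' hcf' (T.drop (pre.length + 1)) prev (sigma0 prev)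
              (pre.length + 1 + 1) Z' _ hplen le_rfl htl hts rfl (sigma0_lt prev)
              (fun i hi => by rw [← hplen]; exact sigma0_cast prev i hi) hZ'' (by ring) hleaf
          rw [hF, if_pos rfl]
          exact List.mem_singleton_self _
        refine hfin _ _ hCf ?_
        -- the leaf state: power-sum and `k·c_k` parts
        rw [show 2 * (pre.length + 1) - pre.length = pre.length + 1 + 1 by omega] at hD
        rw [hprev, packS, ← hS, hlen, packFromD_append, ← hD, List.length_reverse,
          show pre.length + 1 + 1 + pre.length = 2 * (pre.length + 1) by omega]
        simp only [packFromD, add_zero, nodeP, mul_one]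
        push_cast
        ring_nf
      · simp at ha
    · simp only [List.mem_flatMap, mem_icc]
      exact ⟨ak, ⟨hlo, hhi⟩, ih' ha⟩

/-- **Kernel-check form**: certificates for the survivors of `censusSearchPs` certify every survivor of `censusSearchC` at a
node carrying its own power sums (junk leaves carry the `red` certificate found by the kernel). -/
theorem forall_certX_of_allCertifiedPs {Bn Bd d : ℕ} {L : List (List ℤ)} {LC : List (List ℤ × ℤ)} {T : List ℕ}
    {CT : List (List (List ℤ × ℤ))} (hT : ∀ t ∈ T, t < 2 ^ 61) (hTl : T.length ≤ 62) (hdl : d ≤ 62) {NJ fuel : ℕ}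
    {pre : List ℤ} (h1 : 1 ≤ pre.length) (hd : pre.length + fuel = d) (certs : List CertX)
    (h : allCertifiedX Bn Bd d L LC (censusSearchPs T CT d NJ fuel pre) certs = true) :
    ∀ a ∈ censusSearchC T CT fuel pre (psumsRev pre pre.length), ∃ c, checkCertX Bn Bd d L LC (1 :: palC a) c = true := by
  intro a ha
  rcases mem_censusSearchP_or_junk (NJ := NJ) hT hTl hdl fuel pre _ a _ _ _ _ (length_psumsRev _ _) h1 hd rfl rfl rfl rfl ha
    with hP | hj
  · exact exists_certX_of_allCertifiedX _ certs h a hP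
  · exact exists_certX_of_junkK hj

end Summit.Ventures.DiscreteObjects.Mahler
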